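import Summits.ValiantsHypothesis.ValiantsHypothesis.Theses.BarrierLever
import Summits.ValiantsHypothesis.ValiantsHypothesis.Theorems.BarrierLeverTransversalLiteralPairSplit
import Summits.ValiantsHypothesis.ValiantsHypothesis.Theorems.BarrierLeverTransversalTwinFreeReductionHolds
import Summits.ValiantsHypothesis.ValiantsHypothesis.Theorems.BarrierLeverChainCertificateSufficesHolds
import Summits.ValiantsHypothesis.ValiantsHypothesis.Theorems.BarrierLeverSplitReductionSufficesForTransversal
import Summits.ValiantsHypothesis.ValiantsHypothesis.Theorems.BarrierLeverChainCertificatesSufficeForTropicalDet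
import Summits.ValiantsHypothesis.ValiantsHypothesis.Theorems.BarrierLeverChainCertificatesDecideTheCore
import Summits.ValiantsHypothesis.ValiantsHypothesis.Theorems.BarrierLeverTransversalMinorLayoutsLockedComplexes
import Summits.ValiantsHypothesis.ValiantsHypothesis.Theorems.BarrierLeverTransversalSufficesForPrincipal
import Summits.ValiantsHypothesis.ValiantsHypothesis.Theorems.BarrierLeverPrincipalMinorLayoutsNonsingularSuffices

/-!
# Route BarrierLever — the 𝒟-side chain of door (c) with every REDUCTION discharged:
# `PartitionMinorsHitByVP` (item 19717) from the irreducible / locked-complex CORE alone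

Assembly file (`--supports stmt-ValiantsHypothesis-19717`; cell valiant-natproofs, rung V4, 𝒟-side;
prover seat val-np-p1). No new mathematics: it composes tree theorems of five seats so that the
open residue of the line «UT-D ⇒ TT ⇒ TNS ⇒ Nisan partition minors hit by VP» is ONE named
conjecture, with no reduction left as a hypothesis.

Tree inputs (all ✓): R1 `TransversalLiteralPairSplit` (item 19587, `LiteralSplit.…_route`,
val-np-p1) · R2 `TransversalTwinFreeReduction` (19588, `LiteralLift.…_route`, val-np-p1) ·
`ChainCertificateSuffices` (19651, `ChainCert.…_route`, val-np-p1) ·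
`SplitReductionSufficesForTransversal` (19617, `SplitGlue.…`, prover gen 7) ·
`ChainCertificatesSufficeForTropicalDet` (19653) and `ChainCertificatesDecideTheCore` (19659)
(`ChainGlue.…`, prover gen 7) ·
`…Compression.transversalMinorLayoutsNonsingular_of_literalPairSplit_of_lockedComplexes`
(val-np-p2) · `TransversalSufficesForPrincipal` (19153, val-np-p1 g0) ·
`PrincipalMinorLayoutsNonsingularSuffices` (19133, prover gen 5).

**Results (hypothesis ⇒ conclusion, all hypotheses are OPEN conjectures of the route).**
* `transversalMinorLayoutsNonsingular_of_core`: the irreducible core (item 19616) ⇒ TT (19152).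
* `transversalMinorLayoutsNonsingular_of_lockedComplexes`: TT on LOCKED COMPLEX PAIRS (lower-set
  ranges, no equal literal-class sizes; val-np-p2's residue) ⇒ TT.
* `partitionMinorsHitByVP_of_transversal`: TT ⇒ `PartitionMinorsHitByVP` (19717).
* `partitionMinorsHitByVP_of_core`, `partitionMinorsHitByVP_of_lockedComplexes`: the cores ⇒ 19717.
* `tropicalDetCertificatesExist_of_chainCertificatesExist`: `ChainCertificatesExist` (19652) ⇒
  UT-D (19316); `partitionMinorsHitByVP_of_chainCertificatesOnCore`:
  `ChainCertificatesExistOnIrreducibleLayouts` (19658) ⇒ 19717.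

WHAT THIS IS NOT: every hypothesis here (19616 / the locked-complex core / 19652 / 19658) is an
OPEN conjecture with census support only; nothing is proved about them, about TT / TNS / 19717
unconditionally, about crux stmt-ValiantsHypothesis-14610, or about `VP` versus `VNP`.
-/

-- layout Summits/ValiantsHypothesis/ValiantsHypothesis forces the duplicated namespace component
set_option linter.dupNamespace false

namespace Summit.ValiantsHypothesis.ValiantsHypothesis.Theorems.BarrierLever.CoreChain

open Summit.ValiantsHypothesis.ValiantsHypothesis.Theses.BarrierLever
open Summit.ValiantsHypothesis.ValiantsHypothesis.Theorems.BarrierLever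

/-! ## 1. The irreducible core decides TT -/

/-- **The R1/R2-irreducible core (item 19616) ⇒ TT (item 19152)**, with R1 and R2 discharged. -/
theorem transversalMinorLayoutsNonsingular_of_core
    (hcore : TransversalMinorsNonsingularOnIrreducibleLayouts) :
    TransversalMinorLayoutsNonsingular :=
  SplitGlue.splitReductionSufficesForTransversal LiteralSplit.transversalLiteralPairSplit_route
    LiteralLift.transversalTwinFreeReduction_route hcore

/-- **TT on LOCKED COMPLEX PAIRS ⇒ TT** (val-np-p2's residue: both ranges lower sets = simplicial
complexes, injective, and no two literal classes `#{i : (a ∈ u i) = β}`, `#{j : (c ∈ w j) = γ}`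
of equal size), with R1 discharged. -/
theorem transversalMinorLayoutsNonsingular_of_lockedComplexes
    (core : ∀ (h r : ℕ) (u w : Fin r → Finset (Fin h)), Function.Injective u →
      Function.Injective w → IsLowerSet (Set.range u) → IsLowerSet (Set.range w) →
      (∀ (a c : Fin h) (β γ : Bool),
        (Finset.univ.filter fun i => (a ∈ u i ↔ β = true)).card ≠
          (Finset.univ.filter fun j => (c ∈ w j ↔ γ = true)).card) →
      ∃ H : Matrix (Fin (h + h)) (Fin (h + h)) ℂ, (Matrix.of fun i j : Fin r => (H.submatrix
        (fun b : Fin h => if b ∈ u i then Fin.castAdd h b else Fin.natAdd h b)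
        (fun b : Fin h => if b ∈ w j then Fin.natAdd h b else Fin.castAdd h b)).det).det ≠ 0) :
    TransversalMinorLayoutsNonsingular :=
  Compression.transversalMinorLayoutsNonsingular_of_literalPairSplit_of_lockedComplexes
    LiteralSplit.transversalLiteralPairSplit_route core

/-! ## 2. Down to Nisan's partition minors -/

/-- **TT (19152) ⇒ `PartitionMinorsHitByVP` (19717)**: items 19153 (TT ⇒ TNS) and 19133
(TNS ⇒ 19717) composed. -/
theorem partitionMinorsHitByVP_of_transversal (hTT : TransversalMinorLayoutsNonsingular) :
    PartitionMinorsHitByVP :=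
  PrincipalMinorWitness.principalMinorLayoutsNonsingularSuffices
    (TransversalDictionary.transversalSufficesForPrincipal hTT)

/-- **The irreducible core (19616) ⇒ `PartitionMinorsHitByVP` (19717).** -/
theorem partitionMinorsHitByVP_of_core (hcore : TransversalMinorsNonsingularOnIrreducibleLayouts) :
    PartitionMinorsHitByVP :=
  partitionMinorsHitByVP_of_transversal (transversalMinorLayoutsNonsingular_of_core hcore)

/-- **The locked-complex core ⇒ `PartitionMinorsHitByVP` (19717).** -/
theorem partitionMinorsHitByVP_of_lockedComplexes
    (core : ∀ (h r : ℕ) (u w : Fin r → Finset (Fin h)), Function.Injective u →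
      Function.Injective w → IsLowerSet (Set.range u) → IsLowerSet (Set.range w) →
      (∀ (a c : Fin h) (β γ : Bool),
        (Finset.univ.filter fun i => (a ∈ u i ↔ β = true)).card ≠
          (Finset.univ.filter fun j => (c ∈ w j ↔ γ = true)).card) →
      ∃ H : Matrix (Fin (h + h)) (Fin (h + h)) ℂ, (Matrix.of fun i j : Fin r => (H.submatrix
        (fun b : Fin h => if b ∈ u i then Fin.castAdd h b else Fin.natAdd h b)
        (fun b : Fin h => if b ∈ w j then Fin.natAdd h b else Fin.castAdd h b)).det).det ≠ 0) :
    PartitionMinorsHitByVP :=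
  partitionMinorsHitByVP_of_transversal (transversalMinorLayoutsNonsingular_of_lockedComplexes core)

/-! ## 3. The tropical suppliers -/

/-- **`ChainCertificatesExist` (19652) ⇒ UT-D (19316)**, with `ChainCertificateSuffices` (19651)
discharged. -/
theorem tropicalDetCertificatesExist_of_chainCertificatesExist (hE : ChainCertificatesExist) :
    TropicalDetCertificatesExist :=
  ChainGlue.chainCertificatesSufficeForTropicalDet ChainCert.chainCertificateSuffices_route hE

/-- **Chain certificates on the irreducible core (19658) ⇒ the core (19616)**, with 19651
discharged. -/
theorem core_of_chainCertificatesOnCore (hE : ChainCertificatesExistOnIrreducibleLayouts) :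
    TransversalMinorsNonsingularOnIrreducibleLayouts :=
  ChainGlue.chainCertificatesDecideTheCore ChainCert.chainCertificateSuffices_route hE

/-- **Chain certificates on the irreducible core (19658) ⇒ `PartitionMinorsHitByVP` (19717)** — the
weakest typed tropical supplier of the line, every reduction discharged. -/
theorem partitionMinorsHitByVP_of_chainCertificatesOnCore
    (hE : ChainCertificatesExistOnIrreducibleLayouts) : PartitionMinorsHitByVP :=
  partitionMinorsHitByVP_of_core (core_of_chainCertificatesOnCore hE)

end Summit.ValiantsHypothesis.ValiantsHypothesis.Theorems.BarrierLever.CoreChain
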